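import Mathlib
import Summits.Ventures.PercRepro2.SwAllMarkStepMultiRoot

/-!
# THE MARK STEP WITH ANY SET OF JUNCTIONS: THE LOCAL RULES FOR (★) (blind cell PercRepro2,
night-4 g34, 2026-08-29; proofs/NIGHT4-G34.md §9)

On a colour pattern `d` of the mark's edges, a junction `u` of the isolated graph cannot be
blue-connected to `l` (so (★) holds for it) when one of four LOCAL RULES applies:
(A) `u` is a blue neighbour of the mark (the pattern's `𝓓` forbids `u ∈ C_B(l)`);
(B) `u` is a red neighbour of the mark and is joined to `h` (`𝓓″` forbids `u ∈ C_R(h)`, so the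
    h-edge is blue and `u ∈ C_B(l)` would put `h` into the hull of `l`);
(C) `u` is joined to `h` and has a neighbour `p ≠ h` that is a red neighbour of the mark joined to
    `h`, or a blue neighbour of the mark joined to `l`, or a red and a blue neighbour of the mark:
    with `u ∈ C_B(l)` the h-edge is red, `u ∈ C_R(h)`, and the edge `u–p` can be neither red
    (`p ∈ C_R(h)` is forbidden) nor blue (`p ∈ C_B(l) ∖ C_B(h)` is forbidden);
(D) every neighbour `p ≠ h` of `u` is a blue neighbour of the mark or a red neighbour joined to
    `h`: then no blue edge at `u` leads into `C_B(l)`.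
**`swAll_markStep_of_junctions_rules`**: row 2′SW-ALL with the mark on every graph whose junctions
satisfy, on every pattern, one of the rules — the model's token `mr5` (NIGHT4-G34.md §7).
-/

namespace Summit.Ventures.PercRepro2

namespace LocRows

open Hull

variable {V : Type*} {E : Type*} [Fintype E] [DecidableEq E]

open scoped Classical

variable {ends : E → Sym2 V} {l h x : V}

section Rules

variable {d : Config E} {ξ ζ : Config E}
  (hζ : ζ ∈ gOutSide (isolate ends x) l h (markU ends d x) (markD ends d x) (markD'' ends d x) {x}
    Set.univ ({l}ᶜ) ξ)
include hζ

/-- `h` is in neither cluster of `l`. -/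
lemma h_notMem_hull_l_mark : h ∉ hull (isolate ends x) ζ l :=
  (mem_gTypedQ.1 (mem_gOutSide.1 hζ).1).1

/-- A blue neighbour of the mark is not in `C_B(l)`. -/
lemma blueNbr_notMem_cluster_blue_l {u : V} (hu : u ∈ openNbrs ends (blue d) x) :
    u ∉ cluster (isolate ends x) (blue ζ) l :=
  (mem_gTypedQ.1 (mem_gOutSide.1 hζ).1).2.2.1 u hu

/-- A red neighbour of the mark is not in `C_R(h)`. -/
lemma redNbr_notMem_cluster_h {u : V} (hu : u ∈ openNbrs ends d x) :
    u ∉ cluster (isolate ends x) ζ h :=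
  (mem_gTypedQ.1 (mem_gOutSide.1 hζ).1).2.2.2.1 u hu

/-- A vertex of `C_B(l)` is not in `C_B(h)`. -/
lemma notMem_cluster_blue_h_of_mem_cluster_blue_l_mark {u : V}
    (hu : u ∈ cluster (isolate ends x) (blue ζ) l) : u ∉ cluster (isolate ends x) (blue ζ) h :=
  fun h' => h_notMem_hull_l_mark hζ (Or.inr (conn_trans hu (conn_symm h')))

/-- A vertex of `C_B(l)` joined to `h` (in the isolated graph) has a red h-edge and lies in
`C_R(h)`. -/
lemma mem_cluster_h_of_mem_cluster_blue_l {u : V} {e : E} (he : isolate ends x e = s(h, u))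
    (hu : u ∈ cluster (isolate ends x) (blue ζ) l) : u ∈ cluster (isolate ends x) ζ h := by
  cases hζe : ζ e with
  | true => exact mem_cluster_of_edge (mem_cluster_self _ _ _) hζe he
  | false =>
    exfalso
    have hζe' : blue ζ e = true := by rw [blue_eq_true_iff]; exact hζe
    exact notMem_cluster_blue_h_of_mem_cluster_blue_l_mark hζ hu
      (mem_cluster_of_edge (mem_cluster_self _ _ _) hζe' he)

/-- A vertex of `C_R(h)` joined to `l` that is a blue neighbour of the mark does not exist. -/
lemma not_mem_cluster_h_of_blueNbr_joined_l {p : V} {e : E} (he : isolate ends x e = s(p, l))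
    (hpB : p ∈ openNbrs ends (blue d) x) (hp : p ∈ cluster (isolate ends x) ζ h) : False := by
  cases hζe : ζ e with
  | true =>
    exact h_notMem_hull_l_mark hζ (Or.inl (conn_symm (mem_cluster_of_edge hp hζe he)))
  | false =>
    have hζe' : blue ζ e = true := by rw [blue_eq_true_iff]; exact hζe
    exact blueNbr_notMem_cluster_blue_l hζ hpB
      (mem_cluster_of_edge (mem_cluster_self _ _ _) hζe' (ends_swap he))

/-- **Rule (A)**: a blue neighbour of the mark is not in `C_B(l)`. -/
theorem star_ruleA {u : V} (hu : u ∈ openNbrs ends (blue d) x) :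
    u ∉ cluster (isolate ends x) (blue ζ) l :=
  blueNbr_notMem_cluster_blue_l hζ hu

/-- **Rule (B)**: a red neighbour of the mark joined to `h` is not in `C_B(l)`. -/
theorem star_ruleB {u : V} (hu : u ∈ openNbrs ends d x) {e : E} (he : isolate ends x e = s(h, u)) :
    u ∉ cluster (isolate ends x) (blue ζ) l := fun hbl =>
  redNbr_notMem_cluster_h hζ hu (mem_cluster_h_of_mem_cluster_blue_l hζ he hbl)

/-- **Rule (C)**: a junction joined to `h` with a neighbour `p` that is a red neighbour of the mark
joined to `h`, or a blue neighbour of the mark joined to `l`, or a red and a blue neighbour of the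
mark, is not in `C_B(l)`. -/
theorem star_ruleC {u p : V} {e₀ e : E} (he₀ : isolate ends x e₀ = s(h, u))
    (he : isolate ends x e = s(u, p))
    (hp : (p ∈ openNbrs ends d x ∧ ∃ e', isolate ends x e' = s(p, h)) ∨
      (p ∈ openNbrs ends (blue d) x ∧ ∃ e', isolate ends x e' = s(p, l)) ∨
      (p ∈ openNbrs ends d x ∧ p ∈ openNbrs ends (blue d) x)) :
    u ∉ cluster (isolate ends x) (blue ζ) l := by
  intro hbl
  have huR : u ∈ cluster (isolate ends x) ζ h := mem_cluster_h_of_mem_cluster_blue_l hζ he₀ hbl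
  cases hζe : ζ e with
  | true =>
    -- `p ∈ C_R(h)`
    have hpR : p ∈ cluster (isolate ends x) ζ h := mem_cluster_of_edge huR hζe he
    rcases hp with ⟨hpd, -⟩ | ⟨hpB, e', he'⟩ | ⟨hpd, -⟩
    · exact redNbr_notMem_cluster_h hζ hpd hpR
    · exact not_mem_cluster_h_of_blueNbr_joined_l hζ he' hpB hpR
    · exact redNbr_notMem_cluster_h hζ hpd hpR
  | false =>
    -- `p ∈ C_B(l)`
    have hζe' : blue ζ e = true := by rw [blue_eq_true_iff]; exact hζe
    have hpB' : p ∈ cluster (isolate ends x) (blue ζ) l := mem_cluster_of_edge hbl hζe' he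
    rcases hp with ⟨hpd, e', he'⟩ | ⟨hpB, -⟩ | ⟨-, hpB⟩
    · exact redNbr_notMem_cluster_h hζ hpd
        (mem_cluster_h_of_mem_cluster_blue_l hζ (ends_swap he') hpB')
    · exact blueNbr_notMem_cluster_blue_l hζ hpB hpB'
    · exact blueNbr_notMem_cluster_blue_l hζ hpB hpB'

/-- **Rule (D)**: a junction every neighbour `p ≠ h` of which is a blue neighbour of the mark or a
red neighbour of the mark joined to `h` (and with no loop) is not in `C_B(l)`. -/
theorem star_ruleD {u : V} (hul : u ≠ l)
    (hnb : ∀ e p, isolate ends x e = s(u, p) → p ≠ h →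
      p ∈ openNbrs ends (blue d) x ∨ (p ∈ openNbrs ends d x ∧ ∃ e', isolate ends x e' = s(p, h))) :
    u ∉ cluster (isolate ends x) (blue ζ) l := by
  intro hbl
  -- the blue cluster of `l` without `u` is closed under blue adjacency: a blue edge `y–u` from a
  -- vertex `y ∈ C_B(l)` is impossible
  have key : u ∈ {y | y ∈ cluster (isolate ends x) (blue ζ) l ∧ y ≠ u} := by
    refine mem_of_conn_of_closed (ends := isolate ends x) (ω := blue ζ) ?_
      ⟨mem_cluster_self _ _ _, hul.symm⟩ hbl
    rintro y ⟨hy, hyu⟩ z hyz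
    refine ⟨mem_cluster_of_adj hy hyz, ?_⟩
    rintro rfl
    obtain ⟨-, e, he, hyz'⟩ := exists_edge_of_adj hyz
    have he' : ζ e = false := blue_eq_true_iff.1 he
    by_cases hyh : y = h
    · subst hyh
      exact notMem_cluster_blue_h_of_mem_cluster_blue_l_mark hζ hbl
        (mem_cluster_of_edge (mem_cluster_self _ _ _) he hyz')
    rcases hnb e y (ends_swap hyz') hyh with hyB | ⟨hyd, e', he''⟩
    · exact blueNbr_notMem_cluster_blue_l hζ hyB hy
    · exact redNbr_notMem_cluster_h hζ hyd
        (mem_cluster_h_of_mem_cluster_blue_l hζ (ends_swap he'') hy)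
  exact key.2 rfl

end Rules

section MarkStep

/-- **THE MARK STEP WITH ANY SET OF JUNCTIONS SATISFYING THE LOCAL RULES ON EVERY PATTERN**: row
2′SW-ALL with the mark `x` on every graph whose vertices other than `l, h, x` are joined to `l`, hang
on the mark, or belong to a set `J` of junctions (no loop at `h` or at a junction; `l, h, x ∉ J`)
each of which satisfies, on every colour pattern `d` of the mark's edges, one of the rules (A)–(D)
(stated on the isolated graph `isolate ends x`). -/
theorem swAll_markStep_of_junctions_rules (hlh : l ≠ h) (hloop : ∀ e, ends e ≠ s(h, h))
    (hxl : x ≠ l) (hxh : x ≠ h) {J : Finset V} (hlJ : l ∉ J) (hhJ : h ∉ J) (hxJ : x ∉ J)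
    (hloopJ : ∀ u ∈ J, ∀ e, ends e ≠ s(u, u))
    (hrules : ∀ d : Config E, ∀ u ∈ J,
      u ∈ openNbrs ends (blue d) x ∨
      (u ∈ openNbrs ends d x ∧ ∃ e, isolate ends x e = s(h, u)) ∨
      ((∃ e, isolate ends x e = s(h, u)) ∧ ∃ p e, isolate ends x e = s(u, p) ∧
        ((p ∈ openNbrs ends d x ∧ ∃ e', isolate ends x e' = s(p, h)) ∨
         (p ∈ openNbrs ends (blue d) x ∧ ∃ e', isolate ends x e' = s(p, l)) ∨
         (p ∈ openNbrs ends d x ∧ p ∈ openNbrs ends (blue d) x))) ∨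
      (∀ e p, isolate ends x e = s(u, p) → p ≠ h →
        p ∈ openNbrs ends (blue d) x ∨ (p ∈ openNbrs ends d x ∧ ∃ e', isolate ends x e' = s(p, h))))
    (hout : ∀ y, y ≠ l → y ≠ h → y ≠ x → y ∉ J →
      (∃ e, ends e = s(y, l)) ∨ (∀ e, y ∈ ends e → x ∈ ends e)) : SwAll ends l h x := by
  refine swAll_of_gTyped_patterns hxl hxh fun d _ => ?_
  have hloop' : ∀ e r, r ∈ insert h (↑J : Set V) → ends e ≠ s(r, r) := by
    rintro e r (rfl | hr)
    · exact hloop e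
    · exact hloopJ r hr e
  refine gTypedSwAll_of_junctions_star
    (F := fun y => y ∈ openNbrs ends d x ∧ ∀ z ∈ openNbrs ends d x, z = y) (J := J)
    hlh hlJ (isolate_hloop_set hxh hxJ hloop') (isUpperSet_markU d x) (isLowerSet_markD d x)
    (isLowerSet_markD'' d x) isUpperSet_univ ?_ ?_ ?_ ?_ ?_ ?_
  · rintro y ⟨-, huniq⟩ S ⟨z, hz, hzS⟩
    rw [← huniq z hz]
    exact hzS
  · exact fun h' => hxh (Set.mem_singleton_iff.1 h').symm
  · intro u hu h'
    exact hxJ ((Set.mem_singleton_iff.1 h') ▸ hu)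
  · intro y hy _ e hye
    rw [Set.mem_singleton_iff] at hy
    subst hy
    exact isolate_selfLoops e hye
  · intro y hyl hyh hyJ
    by_cases hyx : y = x
    · exact Or.inr (Or.inl (by rw [hyx]; exact Set.mem_singleton _))
    by_cases hyF : y ∈ openNbrs ends d x ∧ ∀ z ∈ openNbrs ends d x, z = y
    · exact Or.inl hyF
    rcases hout y hyl hyh hyx hyJ with ⟨e, he⟩ | hiso
    · exact Or.inr (Or.inr (Or.inl ⟨e, isolate_eq_of_ends_eq hyx hxl.symm he⟩))
    · exact Or.inr (Or.inr (Or.inr (isolate_iso hyx hiso)))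
  · intro ξ ζ hζ u hu hbl
    exfalso
    have hul : u ≠ l := fun h' => hlJ (h' ▸ hu)
    rcases hrules d u hu with hA | ⟨hud, e, he⟩ | ⟨⟨e₀, he₀⟩, p, e, he, hp⟩ | hD
    · exact star_ruleA hζ hA hbl
    · exact star_ruleB hζ hud he hbl
    · exact star_ruleC hζ he₀ he hp hbl
    · exact star_ruleD hζ hul hD hbl

/-- **THE SAME WITH A PATTERN-DEPENDENT SET OF JUNCTIONS** (the model's rule, pattern by pattern):
on every pattern `d` a set `J d` of junctions satisfying the rules, the other vertices joined to
`l`, hanging on the mark, or the unique red neighbour of the mark on that pattern. -/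
theorem swAll_markStep_of_junctions_rules' (hlh : l ≠ h) (hloop : ∀ e, ends e ≠ s(h, h))
    (hxl : x ≠ l) (hxh : x ≠ h) (J : Config E → Finset V)
    (hlJ : ∀ d, l ∉ J d) (hhJ : ∀ d, h ∉ J d) (hxJ : ∀ d, x ∉ J d)
    (hloopJ : ∀ d, ∀ u ∈ J d, ∀ e, ends e ≠ s(u, u))
    (hrules : ∀ d : Config E, ∀ u ∈ J d,
      u ∈ openNbrs ends (blue d) x ∨
      (u ∈ openNbrs ends d x ∧ ∃ e, isolate ends x e = s(h, u)) ∨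
      ((∃ e, isolate ends x e = s(h, u)) ∧ ∃ p e, isolate ends x e = s(u, p) ∧
        ((p ∈ openNbrs ends d x ∧ ∃ e', isolate ends x e' = s(p, h)) ∨
         (p ∈ openNbrs ends (blue d) x ∧ ∃ e', isolate ends x e' = s(p, l)) ∨
         (p ∈ openNbrs ends d x ∧ p ∈ openNbrs ends (blue d) x))) ∨
      (∀ e p, isolate ends x e = s(u, p) → p ≠ h →
        p ∈ openNbrs ends (blue d) x ∨ (p ∈ openNbrs ends d x ∧ ∃ e', isolate ends x e' = s(p, h))))
    (hout : ∀ d : Config E, ∀ y, y ≠ l → y ≠ h → y ≠ x → y ∉ J d →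
      (y ∈ openNbrs ends d x ∧ ∀ z ∈ openNbrs ends d x, z = y) ∨
      (∃ e, ends e = s(y, l)) ∨ (∀ e, y ∈ ends e → x ∈ ends e)) : SwAll ends l h x := by
  refine swAll_of_gTyped_patterns hxl hxh fun d _ => ?_
  have hloop' : ∀ e r, r ∈ insert h (↑(J d) : Set V) → ends e ≠ s(r, r) := by
    rintro e r (rfl | hr)
    · exact hloop e
    · exact hloopJ d r hr e
  refine gTypedSwAll_of_junctions_star
    (F := fun y => y ∈ openNbrs ends d x ∧ ∀ z ∈ openNbrs ends d x, z = y) (J := J d)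
    hlh (hlJ d) (isolate_hloop_set hxh (hxJ d) hloop') (isUpperSet_markU d x) (isLowerSet_markD d x)
    (isLowerSet_markD'' d x) isUpperSet_univ ?_ ?_ ?_ ?_ ?_ ?_
  · rintro y ⟨-, huniq⟩ S ⟨z, hz, hzS⟩
    rw [← huniq z hz]
    exact hzS
  · exact fun h' => hxh (Set.mem_singleton_iff.1 h').symm
  · intro u hu h'
    exact hxJ d ((Set.mem_singleton_iff.1 h') ▸ hu)
  · intro y hy _ e hye
    rw [Set.mem_singleton_iff] at hy
    subst hy
    exact isolate_selfLoops e hye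
  · intro y hyl hyh hyJ
    by_cases hyx : y = x
    · exact Or.inr (Or.inl (by rw [hyx]; exact Set.mem_singleton _))
    rcases hout d y hyl hyh hyx hyJ with hyF | ⟨e, he⟩ | hiso
    · exact Or.inl hyF
    · exact Or.inr (Or.inr (Or.inl ⟨e, isolate_eq_of_ends_eq hyx hxl.symm he⟩))
    · exact Or.inr (Or.inr (Or.inr (isolate_iso hyx hiso)))
  · intro ξ ζ hζ u hu hbl
    exfalso
    have hul : u ≠ l := fun h' => hlJ d (h' ▸ hu)
    rcases hrules d u hu with hA | ⟨hud, e, he⟩ | ⟨⟨e₀, he₀⟩, p, e, he, hp⟩ | hD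
    · exact star_ruleA hζ hA hbl
    · exact star_ruleB hζ hud he hbl
    · exact star_ruleC hζ he₀ he hp hbl
    · exact star_ruleD hζ hul hD hbl

end MarkStep

end LocRows

end Summit.Ventures.PercRepro2
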